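import Mathlib.Algebra.Group.Subgroup.Pointwise
import Literature.AlgebraicGeometry.HodgeTheory.LocallyTrivialExtensionClasses

/-!
# Route LinearSystemTorelli — crux `LocalTubeSpan`: conjugation invariance of the surrogate

Helper file (`--supports stmt-HodgeConjecture-2490`, line `Sketch`, stub `stub_conjInvariant`).
The crux ("local Schnell theorem", C. Schnell, *Primitive cohomology and the tube mapping*,
Math. Z. 268 (2010) = arXiv:0711.3927, §3, §7) is formalised at a subgroup `S ≤ G` — a local
fundamental group `G_{s₀}` of the discriminant complement inside `G = π₁` — by the surrogate
`ker (evalCoinvOn A S) = H1resKer A S`: a class undetected by every single element of `S`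
(`φ g ∈ (g - 1)A` for all `g ∈ S`) restricts to zero on `S`.  A local fundamental group is only
defined up to conjugacy (choice of a view point and of a path to the base point, A. Hatcher,
*Algebraic Topology* (2002) §1.1 Prop. 1.5), so the surrogate must not depend on the conjugate
chosen.  The tree already knows this for the right-hand side (`H1resKer_conj_smul`); the present
file proves it for the kernel of Schnell's third map on a subgroup and concludes:

* `localTubeSpan_cocycles₁_apply_conj_mem_subOneRange` — the element-level identity: if
  `φ g = g·x - x` then `φ (h g h⁻¹) = (h g h⁻¹)·y - y` with `y = h·x - φ h`;
* `localTubeSpan_ker_evalCoinvOn_conj_smul` — `ker (evalCoinvOn A (h S h⁻¹)) = ker (evalCoinvOn A S)`;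
* `localTubeSpan_surrogate_conj_iff` — the registered stub: the surrogate at `h S h⁻¹` is
  equivalent to the surrogate at `S`.

Pure group cohomology over an arbitrary commutative ring `k` and group `G` (Mathlib's
`groupCohomology.H1`, the tree's `LocallyTrivialExtensionClasses`); no named facts.

References: [Schnell2010] C. Schnell, Primitive cohomology and the tube mapping, Math. Z. 268
(2010), §3 (the third map); [HatcherAT2002] A. Hatcher, Algebraic Topology (2002), §1.1 Prop. 1.5
(change of base point is conjugation).
-/

-- `Summit.HodgeConjecture.HodgeConjecture.Theorems` is the mandated namespace (single-conjunct summit: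
-- Sub = Summit), which `linter.dupNamespace` flags on every declaration; the lakefile turns the
-- linter off tree-wide (weak option), restated here so stand-alone elaboration is warning-free too.
set_option linter.dupNamespace false

noncomputable section

open CategoryTheory groupCohomology
open Literature.AlgebraicGeometry.HodgeTheory
open scoped Pointwise

namespace Summit.HodgeConjecture.HodgeConjecture.Theorems

universe u

variable {k G : Type u} [CommRing k] [Group G] (A : Rep k G)

/-! ### Undetectedness is stable under conjugation -/

/-- **Key identity.** If a `1`-cocycle `φ` is undetected by `g` (`φ g ∈ (g - 1)A`, say
`φ g = g·x - x`), then it is undetected by every conjugate `h g h⁻¹`: expanding with the cocycle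
identity, `φ (h g h⁻¹) = (h g h⁻¹)·y - y` for `y = h·x - φ h`. [folklore] -/
theorem localTubeSpan_cocycles₁_apply_conj_mem_subOneRange (φ : cocycles₁ A) (g h : G)
    (hg : φ g ∈ subOneRange A g) : φ (h * g * h⁻¹) ∈ subOneRange A (h * g * h⁻¹) := by
  obtain ⟨x, hx⟩ := LinearMap.mem_range.1 hg
  refine LinearMap.mem_range.2 ⟨A.ρ h x - φ h, ?_⟩
  rw [LinearMap.sub_apply, LinearMap.id_apply] at hx ⊢
  have hc := (mem_cocycles₁_iff φ).1 φ.2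
  have c1 : φ h⁻¹ = -(A.ρ h⁻¹ (φ h)) := by
    have c0 := cocycles₁_map_inv φ h⁻¹
    rw [inv_inv] at c0
    exact neg_eq_iff_eq_neg.1 c0.symm
  have r1 : ∀ y, A.ρ (h * g) (A.ρ h⁻¹ y) = A.ρ (h * g * h⁻¹) y := fun y => by
    rw [← Module.End.mul_apply, ← map_mul]
  have r2 : ∀ y, A.ρ h (A.ρ g y) = A.ρ (h * g * h⁻¹) (A.ρ h y) := fun y => by
    rw [← Module.End.mul_apply, ← map_mul, ← Module.End.mul_apply, ← map_mul,
      inv_mul_cancel_right]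
  rw [hc (h * g) h⁻¹, hc h g, ← hx, c1]
  simp only [map_sub, map_neg, r1, r2]
  abel

/-- The kernel of Schnell's third map on a subgroup, cocycle-wise: `[φ] ∈ ker (evalCoinvOn A S)`
iff `φ g ∈ (g - 1)A` for every `g ∈ S` (`evalCoinvOn_H1π` and `Submodule.Quotient.mk_eq_zero`).
[cite: Schnell2010, §3 (the third map, eq. (restr-M))] -/
theorem localTubeSpan_H1π_mem_ker_evalCoinvOn_iff (S : Subgroup G) (φ : cocycles₁ A) :
    H1π A φ ∈ LinearMap.ker (evalCoinvOn A S) ↔ ∀ g ∈ S, φ g ∈ subOneRange A g := by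
  rw [LinearMap.mem_ker, funext_iff, Subtype.forall]
  refine forall₂_congr fun g _ => ?_
  rw [Pi.zero_apply, evalCoinvOn_H1π, Submodule.mkQ_apply, Submodule.Quotient.mk_eq_zero]

/-- One inclusion of the conjugation invariance: a class undetected by every element of `S` is
undetected by every element of `h S h⁻¹` (apply the key identity to `h⁻¹ g h ∈ S`).
[cite: HatcherAT2002, §1.1 Prop. 1.5] -/
theorem localTubeSpan_ker_evalCoinvOn_le_conj_smul (S : Subgroup G) (h : G) :
    LinearMap.ker (evalCoinvOn A S) ≤ LinearMap.ker (evalCoinvOn A (MulAut.conj h • S)) := by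
  intro ξ hξ
  induction ξ using H1_induction_on with
  | h φ =>
    rw [localTubeSpan_H1π_mem_ker_evalCoinvOn_iff] at hξ ⊢
    intro g hg
    rw [Subgroup.mem_pointwise_smul_iff_inv_smul_mem, ← map_inv, MulAut.smul_def,
      MulAut.conj_apply, inv_inv] at hg
    have key := localTubeSpan_cocycles₁_apply_conj_mem_subOneRange A φ (h⁻¹ * g * h) h (hξ _ hg)
    have e : h * (h⁻¹ * g * h) * h⁻¹ = g := by group
    rwa [e] at key

/-- **Conjugation invariance of the kernel of the third map on a subgroup**:
`ker (evalCoinvOn A (h S h⁻¹)) = ker (evalCoinvOn A S)` (the inclusion for `h`, and for `h⁻¹`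
applied to `h S h⁻¹`). Hence "undetected by the local fundamental group", a subgroup given only
up to conjugacy, is well defined. [cite: HatcherAT2002, §1.1 Prop. 1.5] -/
theorem localTubeSpan_ker_evalCoinvOn_conj_smul (S : Subgroup G) (h : G) :
    LinearMap.ker (evalCoinvOn A (MulAut.conj h • S)) = LinearMap.ker (evalCoinvOn A S) := by
  refine le_antisymm ?_ (localTubeSpan_ker_evalCoinvOn_le_conj_smul A S h)
  have := localTubeSpan_ker_evalCoinvOn_le_conj_smul A (MulAut.conj h • S) h⁻¹
  rwa [map_inv, inv_smul_smul] at this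

/-- **The surrogate crux is conjugation invariant** (registered stub `stub_conjInvariant`): the
local Schnell statement `ker (evalCoinvOn A S) = H1resKer A S` holds at `h S h⁻¹` iff it holds at
`S`, both sides being invariant (`localTubeSpan_ker_evalCoinvOn_conj_smul`, `H1resKer_conj_smul`).
So the surrogate at a local fundamental group — defined only up to conjugacy (view point, path to
the base point) — is a well-posed statement. [cite: HatcherAT2002, §1.1 Prop. 1.5] -/
theorem localTubeSpan_surrogate_conj_iff (S : Subgroup G) (h : G) :
    (LinearMap.ker (evalCoinvOn A (MulAut.conj h • S)) = H1resKer A (MulAut.conj h • S)) ↔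
      (LinearMap.ker (evalCoinvOn A S) = H1resKer A S) := by
  rw [localTubeSpan_ker_evalCoinvOn_conj_smul, H1resKer_conj_smul]

end Summit.HodgeConjecture.HodgeConjecture.Theorems

end
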